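import Mathlib
import HarnessLib

/-!
# ONE-LOOP UNIFORMITY, analytic half — PART 1: the elementary inequalities
# (free-hands support of ⟨stmt-QuantumFields-24197⟩ `SwapVirialDeficit.SwapGluedStiffness`; prequel of ✓`…TwistedLogDetUniform`)

The flux dependence of a twisted-torus log-determinant with one direction summed exactly is `Σ_k log(4sinh²(tω(k)/2) + 4sin²(Φ/2))` (sequel); controlling it
uniformly in the volume needs only:
* §1 `four_sinh_sq_half_eq` (`4 sinh²(x/2) = e^{−x}(e^x − 1)²`), ★ `inv_four_sinh_sq_half_le` (`x ≥ c > 0 ⟹ 1/(4sinh²(x/2)) ≤ e^{−x}/(1−e^{−c})²`),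
  ★ `abs_log_add_sub_log_add_le` (`S > 0`, `a, a′ ∈ [0, A]` ⟹ `|log(S+a) − log(S+a′)| ≤ A/S`), `sinh_le_three_halves_mul` (`0 ≤ z ≤ 1 ⟹ sinh z ≤ 3z/2`,
  from Mathlib's `|e^z − 1 − z| ≤ z²`), `two_thirds_mul_le_arsinh` (`0 ≤ y ≤ 1 ⟹ 2y/3 ≤ arsinh y`), `two_div_pi_mul_min_le_sin` (Jordan on the nearer half:
  `x ∈ [0, π] ⟹ (2/π)·min(x, π − x) ≤ sin x`), `arsinh_sin_ge` (`(4/(3π))·min(x, π − x) ≤ arsinh (sin x)`), `geom_sum_le_inv_one_sub`;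
* §2 ★ `sum_exp_neg_mul_min_le` — the exponential sum over a shifted momentum grid: `Σ_{k<n} e^{−s·min(x₀ + πk/n, π − x₀ − πk/n)} ≤ 2/(1 − e^{−sπ/n})`
  for `s > 0`, `0 ≤ x₀ ≤ π/n` (one geometric sum from each end of `[0, π]`).

HONEST LABEL: classical one-variable real analysis; nothing about any Gibbs state; ⟨24197⟩ ∕ ⟨24194⟩ ∕ ⟨24497⟩ OPEN; own crux ⟨22884⟩ OPEN (blocked-on ⟨19935⟩);
the Yang–Mills mass gap is NOT proved; no summit is proved by a line.  THEOREMS ONLY (0 `def`, 0 `sorry`), standard axioms, Mathlib only.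
Width seat ym-line-sfw-p2-w3 g66 (cell ym-idea-1, free hands), `--supports stmt-QuantumFields-24197`.  References: [folklore].
-/

set_option autoImplicit false

noncomputable section

open Real Finset
open scoped BigOperators

namespace Summit.QuantumFields.YangMills.Theorems.OneLoopUniform

/-! ## §1 Elementary inequalities -/

/-- `4 sinh²(x/2) = e^{−x}·(e^x − 1)²`. [folklore] -/
theorem four_sinh_sq_half_eq (x : ℝ) : 4 * Real.sinh (x / 2) ^ 2 = Real.exp (-x) * (Real.exp x - 1) ^ 2 := by
  rw [Real.sinh_eq]
  have h1 : Real.exp (x / 2) ^ 2 = Real.exp x := by rw [← Real.exp_nat_mul]; ring_nf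
  have h2 : Real.exp (-(x / 2)) ^ 2 = Real.exp (-x) := by rw [← Real.exp_nat_mul]; ring_nf
  have h3 : Real.exp (x / 2) * Real.exp (-(x / 2)) = 1 := by rw [← Real.exp_add]; simp
  have h4 : Real.exp (-x) * Real.exp x = 1 := by rw [← Real.exp_add]; simp
  nlinarith [h1, h2, h3, h4, Real.exp_pos x, Real.exp_pos (-x)]

/-- For `x ≥ c > 0`: `1/(4 sinh²(x/2)) ≤ e^{−x}/(1 − e^{−c})²`. [folklore] -/
theorem inv_four_sinh_sq_half_le {x c : ℝ} (hc : 0 < c) (hx : c ≤ x) :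
    (4 * Real.sinh (x / 2) ^ 2)⁻¹ ≤ Real.exp (-x) / (1 - Real.exp (-c)) ^ 2 := by
  have hx0 : 0 < x := hc.trans_le hx
  have hec : Real.exp (-c) < 1 := by rw [← Real.exp_zero]; exact Real.exp_lt_exp.2 (by linarith)
  have hex : Real.exp (-x) ≤ Real.exp (-c) := Real.exp_le_exp.2 (by linarith)
  have hex1 : Real.exp (-x) < 1 := lt_of_le_of_lt hex hec
  have h1c : 0 < 1 - Real.exp (-c) := by linarith
  have h1x : 1 - Real.exp (-c) ≤ 1 - Real.exp (-x) := by linarith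
  -- `4 sinh²(x/2) = e^{-x}(e^x - 1)² = e^{x}(1 - e^{-x})²`
  have hid : 4 * Real.sinh (x / 2) ^ 2 = Real.exp x * (1 - Real.exp (-x)) ^ 2 := by
    rw [four_sinh_sq_half_eq]
    have h4 : Real.exp (-x) * Real.exp x = 1 := by rw [← Real.exp_add]; simp
    nlinarith [h4, Real.exp_pos x, Real.exp_pos (-x)]
  have hsq : (1 - Real.exp (-c)) ^ 2 ≤ (1 - Real.exp (-x)) ^ 2 := pow_le_pow_left₀ h1c.le h1x 2
  have hpos : 0 < Real.exp x * (1 - Real.exp (-c)) ^ 2 := by positivity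
  have hle : Real.exp x * (1 - Real.exp (-c)) ^ 2 ≤ 4 * Real.sinh (x / 2) ^ 2 := by
    rw [hid]; exact mul_le_mul_of_nonneg_left hsq (Real.exp_pos x).le
  have he : Real.exp (-x) / (1 - Real.exp (-c)) ^ 2 = (Real.exp x * (1 - Real.exp (-c)) ^ 2)⁻¹ := by
    rw [Real.exp_neg, mul_inv, div_eq_mul_inv]
  rw [he]
  exact inv_anti₀ hpos hle

/-- For `S > 0` and `a, a′ ∈ [0, A]`: `|log(S + a) − log(S + a′)| ≤ A/S`. [folklore] -/
theorem abs_log_add_sub_log_add_le {S a a' A : ℝ} (hS : 0 < S) (ha : 0 ≤ a) (haA : a ≤ A) (ha' : 0 ≤ a') (ha'A : a' ≤ A) :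
    |Real.log (S + a) - Real.log (S + a')| ≤ A / S := by
  -- both logs lie in `[log S, log (S + A)]` and `log(S+A) − log S ≤ A/S`
  have hA : 0 ≤ A := ha.trans haA
  have hlo : ∀ {b : ℝ}, 0 ≤ b → Real.log S ≤ Real.log (S + b) := fun hb => Real.log_le_log hS (by linarith)
  have hhi : ∀ {b : ℝ}, 0 ≤ b → b ≤ A → Real.log (S + b) ≤ Real.log (S + A) := fun hb hbA => Real.log_le_log (by linarith) (by linarith)
  have hgap : Real.log (S + A) - Real.log S ≤ A / S := by
    rw [← Real.log_div (by linarith) hS.ne', add_div, div_self hS.ne']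
    have h := Real.log_le_sub_one_of_pos (show 0 < 1 + A / S by positivity)
    linarith
  rw [abs_le]
  constructor <;> linarith [hlo ha, hlo ha', hhi ha haA, hhi ha' ha'A]

/-- `sinh z ≤ 3z/2` for `0 ≤ z ≤ 1` (`e^z ≤ 1 + z + z²`, `e^{−z} ≥ 1 − z`). [folklore] -/
theorem sinh_le_three_halves_mul {z : ℝ} (hz : 0 ≤ z) (hz1 : z ≤ 1) : Real.sinh z ≤ 3 / 2 * z := by
  rw [Real.sinh_eq]
  have h1 : Real.exp z ≤ 1 + z + z ^ 2 := by
    have h := Real.abs_exp_sub_one_sub_id_le (show |z| ≤ 1 by rw [abs_of_nonneg hz]; exact hz1)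
    have := (abs_le.1 h).2
    nlinarith
  have h2 : 1 - z ≤ Real.exp (-z) := by linarith [Real.add_one_le_exp (-z)]
  nlinarith

/-- `2y/3 ≤ arsinh y` for `0 ≤ y ≤ 1`. [folklore] -/
theorem two_thirds_mul_le_arsinh {y : ℝ} (hy : 0 ≤ y) (hy1 : y ≤ 1) : 2 / 3 * y ≤ Real.arsinh y := by
  rw [← Real.sinh_le_sinh, Real.sinh_arsinh]
  have h := sinh_le_three_halves_mul (z := 2 / 3 * y) (by positivity) (by linarith)
  linarith

/-- Jordan's inequality on the nearer half: for `x ∈ [0, π]`, `(2/π)·min(x, π − x) ≤ sin x`. [folklore] -/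
theorem two_div_pi_mul_min_le_sin {x : ℝ} (hx : 0 ≤ x) (hxπ : x ≤ Real.pi) : 2 / Real.pi * min x (Real.pi - x) ≤ Real.sin x := by
  by_cases h : x ≤ Real.pi / 2
  · have hmin : min x (Real.pi - x) = x := min_eq_left (by linarith)
    rw [hmin]
    exact Real.mul_le_sin hx h
  · have h : Real.pi / 2 < x := lt_of_not_ge h
    have hmin : min x (Real.pi - x) = Real.pi - x := min_eq_right (by linarith)
    rw [hmin, ← Real.sin_pi_sub]
    exact Real.mul_le_sin (by linarith) (by linarith)

/-- For `x ∈ [0, π]`: `(4/(3π))·min(x, π − x) ≤ arsinh (sin x)` (Jordan's inequality on the nearer half). [folklore] -/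
theorem arsinh_sin_ge {x : ℝ} (hx : 0 ≤ x) (hxπ : x ≤ Real.pi) : 4 / (3 * Real.pi) * min x (Real.pi - x) ≤ Real.arsinh (Real.sin x) := by
  have hs0 : 0 ≤ Real.sin x := Real.sin_nonneg_of_nonneg_of_le_pi hx hxπ
  have hs1 : Real.sin x ≤ 1 := Real.sin_le_one x
  have hj : 2 / Real.pi * min x (Real.pi - x) ≤ Real.sin x := two_div_pi_mul_min_le_sin hx hxπ
  have h := two_thirds_mul_le_arsinh hs0 hs1
  have hπ : 0 < Real.pi := Real.pi_pos
  calc 4 / (3 * Real.pi) * min x (Real.pi - x) = 2 / 3 * (2 / Real.pi * min x (Real.pi - x)) := by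
        field_simp; ring
    _ ≤ 2 / 3 * Real.sin x := by gcongr
    _ ≤ _ := h

/-! ## §2 The one-dimensional exponential sum over a shifted momentum grid -/

/-- A truncated geometric sum with ratio `r ∈ [0,1)` is at most `1/(1 − r)`. [folklore] -/
theorem geom_sum_le_inv_one_sub {r : ℝ} (hr0 : 0 ≤ r) (hr1 : r < 1) (n : ℕ) : ∑ k ∈ range n, r ^ k ≤ 1 / (1 - r) := by
  have h1 : 0 < 1 - r := by linarith
  have key : (∑ k ∈ range n, r ^ k) * (1 - r) = 1 - r ^ n := by
    have h := geom_sum_mul_neg r n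
    linarith [h]
  rw [le_div_iff₀ h1, key]
  linarith [pow_nonneg hr0 n]

/-- ★ **The exponential sum over the shifted grid `x_k = x₀ + πk/n`, `0 ≤ x₀ ≤ π/n`, with the distance to `{0, π}` in the exponent**:
`Σ_{k<n} e^{−s·min(x_k, π − x_k)} ≤ 2/(1 − e^{−sπ/n})` for `s > 0` (two geometric sums, one from each end). [folklore] -/
theorem sum_exp_neg_mul_min_le {n : ℕ} (hn : 0 < n) {s x₀ : ℝ} (hs : 0 < s) (hx₀ : 0 ≤ x₀) (hx₀' : x₀ ≤ Real.pi / n) :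
    ∑ k ∈ range n, Real.exp (-(s * min (x₀ + Real.pi * k / n) (Real.pi - (x₀ + Real.pi * k / n)))) ≤
      2 / (1 - Real.exp (-(s * Real.pi / n))) := by
  have hnr : (0 : ℝ) < n := by exact_mod_cast hn
  set r : ℝ := Real.exp (-(s * Real.pi / n)) with hr
  have hr0 : 0 ≤ r := (Real.exp_pos _).le
  have hr1 : r < 1 := by
    have hπ := Real.pi_pos
    have h : 0 < s * Real.pi / n := by positivity
    rw [hr, ← Real.exp_zero]; exact Real.exp_lt_exp.2 (by linarith)
  have hrk : ∀ k : ℕ, r ^ k = Real.exp (-(s * (Real.pi * k / n))) := fun k => by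
    rw [hr, ← Real.exp_nat_mul]; congr 1; ring
  -- split the min
  have hsplit : ∀ k ∈ range n, Real.exp (-(s * min (x₀ + Real.pi * k / n) (Real.pi - (x₀ + Real.pi * k / n)))) ≤
      r ^ k + r ^ (n - 1 - k) := by
    intro k hk
    rw [Finset.mem_range] at hk
    have hkle : k ≤ n - 1 := by omega
    have hcast : ((n - 1 - k : ℕ) : ℝ) = (n : ℝ) - 1 - k := by
      rw [Nat.cast_sub hkle, Nat.cast_sub (by omega : 1 ≤ n)]; push_cast; ring
    have hA : Real.exp (-(s * (x₀ + Real.pi * k / n))) ≤ r ^ k := by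
      rw [hrk, Real.exp_le_exp]
      have : 0 ≤ s * x₀ := by positivity
      nlinarith
    have hB : Real.exp (-(s * (Real.pi - (x₀ + Real.pi * k / n)))) ≤ r ^ (n - 1 - k) := by
      rw [hrk, hcast, Real.exp_le_exp]
      -- `π(n-1-k)/n ≤ π − x₀ − πk/n` since `x₀ ≤ π/n`
      have hπ := Real.pi_pos
      have h1 : Real.pi * ((n : ℝ) - 1 - k) / n = Real.pi - Real.pi / n - Real.pi * k / n := by field_simp
      rw [h1]
      nlinarith
    rcases min_cases (x₀ + Real.pi * k / n) (Real.pi - (x₀ + Real.pi * k / n)) with ⟨hm, -⟩ | ⟨hm, -⟩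
    · rw [hm]; linarith [pow_nonneg hr0 (n - 1 - k)]
    · rw [hm]; linarith [pow_nonneg hr0 k]
  calc ∑ k ∈ range n, Real.exp (-(s * min (x₀ + Real.pi * k / n) (Real.pi - (x₀ + Real.pi * k / n))))
      ≤ ∑ k ∈ range n, (r ^ k + r ^ (n - 1 - k)) := Finset.sum_le_sum hsplit
    _ = (∑ k ∈ range n, r ^ k) + ∑ k ∈ range n, r ^ (n - 1 - k) := Finset.sum_add_distrib
    _ = (∑ k ∈ range n, r ^ k) + ∑ k ∈ range n, r ^ k := by rw [Finset.sum_range_reflect (fun k => r ^ k) n]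
    _ ≤ 1 / (1 - r) + 1 / (1 - r) := add_le_add (geom_sum_le_inv_one_sub hr0 hr1 n) (geom_sum_le_inv_one_sub hr0 hr1 n)
    _ = 2 / (1 - r) := by ring

end Summit.QuantumFields.YangMills.Theorems.OneLoopUniform

end
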